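import Summits.ResolutionOfSingularities.ResolutionOfSingularities.Theorems.FrobeniusLadderFInjectiveMacaulayficationEtaleModelTransport
import Mathlib.RingTheory.TensorProduct.Quotient
import HarnessLib

/-!
# The étale transport layer, II: the quotient leg (F4(c) on the hypersurface rings)

[OURS · L1 W4.5a] Support file (`--supports stmt-ResolutionOfSingularities-15315 --as helper`); theorems only; pure commutative algebra;
unconditional. Nothing of the crux is proved; no census.

A LEG `R → R′` (`[Module.Flat R R′]`, `𝔪_R·R′ = 𝔪_{R′}`, Noetherian local both) and a proper ideal `I ⊂ R` induce the QUOTIENT LEG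
`R/I → R′/I·R′`: again flat (`R′/IR′ ≅ R/I ⊗_R R′`, Mathlib `quotIdealMapEquivQuotTensor`) with `𝔪`-extension (Literature
`map_maximalIdeal_quotientMap_eq`). Hence, by part I (✓ `EtaleModelTransport` §1), WITHOUT Fedder and WITHOUT regularity of the ambient
rings: `dim`, `IsRegularLocalRing`, `CMCl` are invariant and `FCl`/`FullCl` descend along `R/I → R′/IR′` (§1); §2 specialises to a
hypersurface `I = (f)` and a second generator `f′` of `(φ f)` (`R′/(f′)`, the letters' shape: `φ(Φ_model) = unit · f_actual`).
[cite: Matsumura1987, Thm. 7.5, Thm. 15.1, Thm. 23.3, Thm. 23.7]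
-/

-- single-problem summit: the doubled namespace component is forced
set_option linter.dupNamespace false

noncomputable section

namespace Summit.ResolutionOfSingularities.ResolutionOfSingularities.Theorems.FInjectiveMacaulayfication.EtaleModelTransport

open IsLocalRing Literature.AlgebraicGeometry.Resolution
open Summit.ResolutionOfSingularities.ResolutionOfSingularities.Theorems.FInjectiveMacaulayfication SliceableCentre
open scoped TensorProduct

variable {R R' : Type} [CommRing R] [CommRing R'] [Algebra R R'] [IsLocalRing R] [IsLocalRing R']

/-! ## §1 The quotient leg `R/I → R′/I·R′` -/

section QuotientLeg

omit [IsLocalRing R] [IsLocalRing R'] in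
/-- **The quotient leg is flat**: `R′/IR′ ≅ R/I ⊗_R R′`. [Mathlib `Algebra.TensorProduct.quotIdealMapEquivQuotTensor`; cite: Matsumura1987, Thm. 7.5] -/
theorem flat_quotient_leg [Module.Flat R R'] (I : Ideal R) : Module.Flat (R ⧸ I) (R' ⧸ I.map (algebraMap R R')) :=
  Module.Flat.of_linearEquiv (Algebra.TensorProduct.quotIdealMapEquivQuotTensor R' I).toLinearEquiv

/-- A proper ideal extends to a proper ideal along a leg. [plumbing] -/
theorem map_ne_top_of_leg (hunr : (maximalIdeal R).map (algebraMap R R') = maximalIdeal R') {I : Ideal R} (hI : I ≠ ⊤) :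
    I.map (algebraMap R R') ≠ ⊤ := fun h =>
  (maximalIdeal.isMaximal R').ne_top (top_le_iff.1 (h ▸ hunr ▸ Ideal.map_mono (le_maximalIdeal hI)))

/-- **The quotient leg has `𝔪`-extension** `𝔪_{R/I}·(R′/IR′) = 𝔪_{R′/IR′}`. [Literature `map_maximalIdeal_quotientMap_eq`; cite: Matsumura1987, Thm. 23.7] -/
theorem hunr_quotient_leg (hunr : (maximalIdeal R).map (algebraMap R R') = maximalIdeal R') {I : Ideal R} (hI : I ≠ ⊤) :
    haveI : Nontrivial (R ⧸ I) := Ideal.Quotient.nontrivial_iff.mpr hI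
    haveI : Nontrivial (R' ⧸ I.map (algebraMap R R')) := Ideal.Quotient.nontrivial_iff.mpr (map_ne_top_of_leg hunr hI)
    haveI := IsLocalRing.of_surjective' (Ideal.Quotient.mk I) Ideal.Quotient.mk_surjective
    haveI := IsLocalRing.of_surjective' (Ideal.Quotient.mk (I.map (algebraMap R R'))) Ideal.Quotient.mk_surjective
    (maximalIdeal (R ⧸ I)).map (algebraMap (R ⧸ I) (R' ⧸ I.map (algebraMap R R'))) = maximalIdeal (R' ⧸ I.map (algebraMap R R')) := by
  haveI : Nontrivial (R ⧸ I) := Ideal.Quotient.nontrivial_iff.mpr hI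
  haveI : Nontrivial (R' ⧸ I.map (algebraMap R R')) := Ideal.Quotient.nontrivial_iff.mpr (map_ne_top_of_leg hunr hI)
  exact map_maximalIdeal_quotientMap_eq hunr I

/-- **`dim R′/IR′ = dim R/I`.** [cite: Matsumura1987, Thm. 15.1] -/
theorem ringKrullDim_quotient_eq [IsNoetherianRing R] [IsNoetherianRing R'] [Module.Flat R R']
    (hunr : (maximalIdeal R).map (algebraMap R R') = maximalIdeal R') {I : Ideal R} (hI : I ≠ ⊤) :
    ringKrullDim (R' ⧸ I.map (algebraMap R R')) = ringKrullDim (R ⧸ I) := by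
  haveI : Nontrivial (R ⧸ I) := Ideal.Quotient.nontrivial_iff.mpr hI
  haveI : Nontrivial (R' ⧸ I.map (algebraMap R R')) := Ideal.Quotient.nontrivial_iff.mpr (map_ne_top_of_leg hunr hI)
  haveI := IsLocalRing.of_surjective' (Ideal.Quotient.mk I) Ideal.Quotient.mk_surjective
  haveI := IsLocalRing.of_surjective' (Ideal.Quotient.mk (I.map (algebraMap R R'))) Ideal.Quotient.mk_surjective
  haveI := flat_quotient_leg (R := R) (R' := R') I
  exact ringKrullDim_eq (hunr_quotient_leg hunr hI)

/-- ★ **REGULARITY OF `R/I` IS ÉTALE-LOCAL**: `IsRegularLocalRing (R′/IR′) ↔ IsRegularLocalRing (R/I)` (no regularity of `R, R′` needed). [cite: Matsumura1987, Thm. 23.7] -/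
theorem isRegularLocalRing_quotient_iff [IsNoetherianRing R] [IsNoetherianRing R'] [Module.Flat R R']
    (hunr : (maximalIdeal R).map (algebraMap R R') = maximalIdeal R') {I : Ideal R} (hI : I ≠ ⊤) :
    IsRegularLocalRing (R' ⧸ I.map (algebraMap R R')) ↔ IsRegularLocalRing (R ⧸ I) := by
  haveI : Nontrivial (R ⧸ I) := Ideal.Quotient.nontrivial_iff.mpr hI
  haveI : Nontrivial (R' ⧸ I.map (algebraMap R R')) := Ideal.Quotient.nontrivial_iff.mpr (map_ne_top_of_leg hunr hI)
  haveI := IsLocalRing.of_surjective' (Ideal.Quotient.mk I) Ideal.Quotient.mk_surjective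
  haveI := IsLocalRing.of_surjective' (Ideal.Quotient.mk (I.map (algebraMap R R'))) Ideal.Quotient.mk_surjective
  haveI := flat_quotient_leg (R := R) (R' := R') I
  exact isRegularLocalRing_iff (hunr_quotient_leg hunr hI)

/-- ★ **THE CM CLAUSE OF `R/I` IS ÉTALE-LOCAL** (both ways; F4(c)). [cite: Matsumura1987, Thm. 23.3] -/
theorem cmCl_quotient_iff [IsNoetherianRing R] [IsNoetherianRing R'] [Module.Flat R R']
    (hunr : (maximalIdeal R).map (algebraMap R R') = maximalIdeal R') {I : Ideal R} (hI : I ≠ ⊤) :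
    CMCl (R' ⧸ I.map (algebraMap R R')) ↔ CMCl (R ⧸ I) := by
  haveI : Nontrivial (R ⧸ I) := Ideal.Quotient.nontrivial_iff.mpr hI
  haveI : Nontrivial (R' ⧸ I.map (algebraMap R R')) := Ideal.Quotient.nontrivial_iff.mpr (map_ne_top_of_leg hunr hI)
  haveI := IsLocalRing.of_surjective' (Ideal.Quotient.mk I) Ideal.Quotient.mk_surjective
  haveI := IsLocalRing.of_surjective' (Ideal.Quotient.mk (I.map (algebraMap R R'))) Ideal.Quotient.mk_surjective
  haveI := flat_quotient_leg (R := R) (R' := R') I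
  exact cmCl_iff (hunr_quotient_leg hunr hI)

/-- ★ **`FCl` OF `R/I` DESCENDS along the quotient leg.** [folklore; cite: Matsumura1987, Thm. 7.5] -/
theorem fCl_of_quotient_leg (p : ℕ) [IsNoetherianRing R] [IsNoetherianRing R'] [Module.Flat R R']
    (hunr : (maximalIdeal R).map (algebraMap R R') = maximalIdeal R') {I : Ideal R} (hI : I ≠ ⊤)
    (h : FCl p (R' ⧸ I.map (algebraMap R R'))) : FCl p (R ⧸ I) := by
  haveI : Nontrivial (R ⧸ I) := Ideal.Quotient.nontrivial_iff.mpr hI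
  haveI : Nontrivial (R' ⧸ I.map (algebraMap R R')) := Ideal.Quotient.nontrivial_iff.mpr (map_ne_top_of_leg hunr hI)
  haveI := IsLocalRing.of_surjective' (Ideal.Quotient.mk I) Ideal.Quotient.mk_surjective
  haveI := IsLocalRing.of_surjective' (Ideal.Quotient.mk (I.map (algebraMap R R'))) Ideal.Quotient.mk_surjective
  haveI := flat_quotient_leg (R := R) (R' := R') I
  exact fCl_of_leg p (hunr_quotient_leg hunr hI) h

/-- ★★ **FULL OF `R/I` DESCENDS along the quotient leg** (NOT-FULL of the model is visible on the actual space, and conversely FULL of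
the apex gives FULL of the foot). [OURS] -/
theorem fullCl_of_quotient_leg (p : ℕ) [IsNoetherianRing R] [IsNoetherianRing R'] [Module.Flat R R']
    (hunr : (maximalIdeal R).map (algebraMap R R') = maximalIdeal R') {I : Ideal R} (hI : I ≠ ⊤)
    (h : FullCl p (R' ⧸ I.map (algebraMap R R'))) : FullCl p (R ⧸ I) := by
  haveI : Nontrivial (R ⧸ I) := Ideal.Quotient.nontrivial_iff.mpr hI
  haveI : Nontrivial (R' ⧸ I.map (algebraMap R R')) := Ideal.Quotient.nontrivial_iff.mpr (map_ne_top_of_leg hunr hI)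
  haveI := IsLocalRing.of_surjective' (Ideal.Quotient.mk I) Ideal.Quotient.mk_surjective
  haveI := IsLocalRing.of_surjective' (Ideal.Quotient.mk (I.map (algebraMap R R'))) Ideal.Quotient.mk_surjective
  haveI := flat_quotient_leg (R := R) (R' := R') I
  exact fullCl_of_leg p (hunr_quotient_leg hunr hI) h

end QuotientLeg

/-! ## §2 Hypersurface specialisation `I = (f)`, second generator `f′` of `(φ f)` -/

section HypersurfaceLeg

omit [IsLocalRing R] [IsLocalRing R'] in
/-- `(f)·R′ = (f′)` when `(φ f) = (f′)`. [plumbing] -/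
theorem map_span_singleton_eq (f : R) (f' : R') (hspan : Ideal.span ({algebraMap R R' f} : Set R') = Ideal.span {f'}) :
    (Ideal.span ({f} : Set R)).map (algebraMap R R') = Ideal.span {f'} := by
  rw [Ideal.map_span, Set.image_singleton, hspan]

/-- `(f) ≠ ⊤` for `f ∈ 𝔪`. [plumbing] -/
theorem span_singleton_ne_top {f : R} (hfm : f ∈ maximalIdeal R) : Ideal.span ({f} : Set R) ≠ ⊤ := fun h =>
  (maximalIdeal.isMaximal R).ne_top (top_le_iff.1 (h ▸ (Ideal.span_singleton_le_iff_mem _).2 hfm))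

/-- ★ **REGULARITY OF THE HYPERSURFACE IS ÉTALE-LOCAL**: `IsRegularLocalRing (R′/(f′)) ↔ IsRegularLocalRing (R/(f))`. [cite: Matsumura1987, Thm. 23.7] -/
theorem isRegularLocalRing_hypersurface_leg_iff [IsNoetherianRing R] [IsNoetherianRing R'] [Module.Flat R R']
    (hunr : (maximalIdeal R).map (algebraMap R R') = maximalIdeal R') (f : R) (hfm : f ∈ maximalIdeal R) (f' : R')
    (hspan : Ideal.span ({algebraMap R R' f} : Set R') = Ideal.span {f'}) :
    IsRegularLocalRing (R' ⧸ Ideal.span ({f'} : Set R')) ↔ IsRegularLocalRing (R ⧸ Ideal.span ({f} : Set R)) := by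
  rw [← map_span_singleton_eq f f' hspan]
  exact isRegularLocalRing_quotient_iff hunr (span_singleton_ne_top hfm)

/-- ★ **THE CM CLAUSE OF THE HYPERSURFACE IS ÉTALE-LOCAL** (F4(c), both ways): `CMCl (R′/(f′)) ↔ CMCl (R/(f))`. [cite: Matsumura1987, Thm. 23.3] -/
theorem cmCl_hypersurface_leg_iff [IsNoetherianRing R] [IsNoetherianRing R'] [Module.Flat R R']
    (hunr : (maximalIdeal R).map (algebraMap R R') = maximalIdeal R') (f : R) (hfm : f ∈ maximalIdeal R) (f' : R')
    (hspan : Ideal.span ({algebraMap R R' f} : Set R') = Ideal.span {f'}) :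
    CMCl (R' ⧸ Ideal.span ({f'} : Set R')) ↔ CMCl (R ⧸ Ideal.span ({f} : Set R)) := by
  rw [← map_span_singleton_eq f f' hspan]
  exact cmCl_quotient_iff hunr (span_singleton_ne_top hfm)

/-- **`dim R′/(f′) = dim R/(f)`.** [cite: Matsumura1987, Thm. 15.1] -/
theorem ringKrullDim_hypersurface_leg_eq [IsNoetherianRing R] [IsNoetherianRing R'] [Module.Flat R R']
    (hunr : (maximalIdeal R).map (algebraMap R R') = maximalIdeal R') (f : R) (hfm : f ∈ maximalIdeal R) (f' : R')
    (hspan : Ideal.span ({algebraMap R R' f} : Set R') = Ideal.span {f'}) :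
    ringKrullDim (R' ⧸ Ideal.span ({f'} : Set R')) = ringKrullDim (R ⧸ Ideal.span ({f} : Set R)) := by
  rw [← map_span_singleton_eq f f' hspan]
  exact ringKrullDim_quotient_eq hunr (span_singleton_ne_top hfm)

/-- ★★ **FULL OF THE HYPERSURFACE DESCENDS**: `FullCl p (R′/(f′)) → FullCl p (R/(f))` — no Fedder, no regularity of `R, R′`. [OURS] -/
theorem fullCl_of_hypersurface_leg' (p : ℕ) [IsNoetherianRing R] [IsNoetherianRing R'] [Module.Flat R R']
    (hunr : (maximalIdeal R).map (algebraMap R R') = maximalIdeal R') (f : R) (hfm : f ∈ maximalIdeal R) (f' : R')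
    (hspan : Ideal.span ({algebraMap R R' f} : Set R') = Ideal.span {f'}) (h : FullCl p (R' ⧸ Ideal.span ({f'} : Set R'))) :
    FullCl p (R ⧸ Ideal.span ({f} : Set R)) := by
  rw [← map_span_singleton_eq f f' hspan] at h
  exact fullCl_of_quotient_leg p hunr (span_singleton_ne_top hfm) h

/-- ★ **`FCl` OF THE HYPERSURFACE DESCENDS.** [OURS] -/
theorem fCl_of_hypersurface_leg (p : ℕ) [IsNoetherianRing R] [IsNoetherianRing R'] [Module.Flat R R']
    (hunr : (maximalIdeal R).map (algebraMap R R') = maximalIdeal R') (f : R) (hfm : f ∈ maximalIdeal R) (f' : R')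
    (hspan : Ideal.span ({algebraMap R R' f} : Set R') = Ideal.span {f'}) (h : FCl p (R' ⧸ Ideal.span ({f'} : Set R'))) :
    FCl p (R ⧸ Ideal.span ({f} : Set R)) := by
  rw [← map_span_singleton_eq f f' hspan] at h
  exact fCl_of_quotient_leg p hunr (span_singleton_ne_top hfm) h

end HypersurfaceLeg

end Summit.ResolutionOfSingularities.ResolutionOfSingularities.Theorems.FInjectiveMacaulayfication.EtaleModelTransport

end
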